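import Mathlib

/-!
# SoloBlind kernel #208 — Euler's half-term identity for alternating sums

For any sequence `g` in a commutative ring,
`2 · Σ_{j ≤ n} (-1)^j g j = g 0 + (-1)^n g n + Σ_{j < n} (-1)^j (g j - g (j+1))`.
Applied twice, an alternating sum of a slowly varying sequence equals half its end terms up to
second differences.  This is the cancellation mechanism of SB-C1103: the flux state's outgoing
pattern pairs against the band-edge Gaussian mode through an alternating sum whose leading
(half-first-term) part cancels the site-1 defect exactly, so the band-edge pair of LEMMA R is
excited only at order `√ε`.
-/

namespace Summit.AnomalousDissipation.AnomalousDissipation.Theorems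

open Finset

/-- Euler's half-term identity: twice an alternating sum equals the two end terms plus the
alternating sum of first differences. -/
theorem two_mul_alternating_sum {R : Type*} [CommRing R] (g : ℕ → R) (n : ℕ) :
    2 * ∑ j ∈ range (n + 1), (-1 : R) ^ j * g j =
      g 0 + (-1 : R) ^ n * g n + ∑ j ∈ range n, (-1 : R) ^ j * (g j - g (j + 1)) := by
  induction n with
  | zero => simp; ring
  | succ n ih =>
    rw [sum_range_succ, mul_add, ih, sum_range_succ, pow_succ]
    ring

/-- The same identity with the differences summed once more: the alternating sum of first
differences is itself governed by the half-term rule, so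
`4 · Σ_{j ≤ n+1} (-1)^j g j` equals end terms, end first differences, and the alternating sum
of second differences `g j - 2 g (j+1) + g (j+2)`. -/
theorem four_mul_alternating_sum {R : Type*} [CommRing R] (g : ℕ → R) (n : ℕ) :
    4 * ∑ j ∈ range (n + 2), (-1 : R) ^ j * g j =
      2 * (g 0 + (-1 : R) ^ (n + 1) * g (n + 1)) + (g 0 - g 1) + (-1 : R) ^ n * (g n - g (n + 1)) +
        ∑ j ∈ range n, (-1 : R) ^ j * (g j - 2 * g (j + 1) + g (j + 2)) := by
  have h1 := two_mul_alternating_sum g (n + 1)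
  have h2 := two_mul_alternating_sum (fun j => g j - g (j + 1)) n
  have e : (4 : R) * ∑ j ∈ range (n + 2), (-1 : R) ^ j * g j =
      2 * (2 * ∑ j ∈ range (n + 1 + 1), (-1 : R) ^ j * g j) := by ring
  rw [e, h1]
  have e2 : ∀ j, g j - g (j + 1) - (g (j + 1) - g (j + 1 + 1)) = g j - 2 * g (j + 1) + g (j + 2) := by
    intro j; ring
  simp only [e2] at h2
  linear_combination h2

end Summit.AnomalousDissipation.AnomalousDissipation.Theorems
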